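import Summits.AtomisticToContinuum.HydrodynamicLimit.Theorems.JParityClosureParityBandClosureStressIsotropyOfWindowCovarianceG
import Summits.AtomisticToContinuum.HydrodynamicLimit.Theorems.JParityClosureParityBandClosureStressIsotropyOfWindowCovarianceI
import Summits.AtomisticToContinuum.HydrodynamicLimit.Theorems.JParityClosureParityBandClosureStressIsotropyOfWindowCovarianceJ
import HarnessLib

/-!
# Window-to-cone step of `ParityBandClosure` — helper K: the deterministic core and the pathwise bound

Support file for the stub `stub_stressIsotropyOfWindowCovariance` of the line `transfer-weighted-parity-chain`
(skeleton v4) of the crux `JParityClosure.ParityBandClosure` (stmt-AtomisticToContinuum-17608).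

* §2 `windows_integral_le` — along ONE hard-sphere trajectory on `𝕋³`, the one-window estimate (helper G) integrated
  over all windows `(t₀, x) ∈ [r², t − r²] × 𝕋³` through the `ℝ≥0∞`-valued Tonelli bounds of helpers I, J:
  `|∫_{t₀} ∫ₓ ∫_s bt·(g(σ³ρ_r) a:P_r)| ≤ A(D₊ + D₋) + Gb·3A(4V·B_m + 4V²·B_ρ + 10𝒯) + 30(Gb κ_a + A κ_g) ke τ
   + (Gb A σ³R/λ)(60 V² B_ρ + 30 𝒯)`, `B_m = 16 ke r τ + (N+1)⁻¹ 8εr 𝒮(0,τ]`, `B_ρ = 8r(½ + ke)τ`,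
  `𝒯 = ∫_{[0,τ]} (N+1)⁻¹ Σ sqTail V (vᵢ(s)) ds`, `D_± =` the `WindowCovarianceIsotropy` functionals of `g_± = max(±g, 0)`.
* §4 `pathwise_bound` — along ONE good orbit of the hard-sphere flow at reduced diameter `σ < 1/2`, the functional of
  `WeakStressIsotropyInBand` is bounded by `4r²(30 Gb A K_E) +` the above with the trajectory quantities replaced by
  the constants of the good events (energy `K_E`, quartic collision statistic `K_b` of `CollisionTightness` through the
  speed-jump bound of helper D, tails `κ_T`, `D_± ≤ η_W`): time sandwich (helper E), Fubini per window centre, §2.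

REFERENCES.  Helpers D, E, G, I, J of this stub; Tonelli.
-/

noncomputable section

namespace Summit.AtomisticToContinuum.HydrodynamicLimit.Theorems.ParityBandClosureWindowToCone

open scoped BigOperators Topology Classical MeasureTheory ENNReal InnerProductSpace
open Filter Set MeasureTheory Function
open Literature.MathematicalPhysics.KineticTheory
open Literature.Analysis.FluidPDE
open Literature.Analysis.FunctionSpaces
open Summit.AtomisticToContinuum.HydrodynamicLimit.Theorems.LocalSecondLawNegative
open Summit.AtomisticToContinuum.HydrodynamicLimit.Theorems.LocalSecondLawLedger
open Summit.AtomisticToContinuum.HydrodynamicLimit.Theorems.ChaosClosesEulerReduction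
open Summit.AtomisticToContinuum.HydrodynamicLimit.Theorems.ChaosClosesEulerStressIsotropy
open Summit.AtomisticToContinuum.HydrodynamicLimit.Theorems.ChaosClosesEulerWindowedInvariance (tent_nonneg_le cone_nonneg_le)

variable {N : ℕ}

/-! ## §1 Splitting double Lebesgue integrals -/

/-- Additivity of the double Lebesgue integral over the windows (left summand measurable). [folklore] -/
theorem ll_add {f : ℝ × T3 → ℝ≥0∞} {g : ℝ → T3 → ℝ≥0∞} (hf : Measurable f) (I : Set ℝ) :
    ∫⁻ t₀ in I, ∫⁻ x, (f (t₀, x) + g t₀ x) = (∫⁻ t₀ in I, ∫⁻ x, f (t₀, x)) + ∫⁻ t₀ in I, ∫⁻ x, g t₀ x := by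
  have h1 : ∀ t₀, Measurable fun x : T3 => f (t₀, x) := fun t₀ => (Measurable.comp hf (measurable_const.prodMk measurable_id) :)
  have h2 : Measurable fun t₀ : ℝ => ∫⁻ x, f (t₀, x) := hf.lintegral_prod_right'
  rw [← lintegral_add_left h2]
  exact lintegral_congr fun t₀ => lintegral_add_left (h1 t₀) _

/-- Constants come out of the double Lebesgue integral. [folklore] -/
theorem ll_const_mul (f : ℝ × T3 → ℝ≥0∞) (c : ℝ) (I : Set ℝ) :
    ∫⁻ t₀ in I, ∫⁻ x, ENNReal.ofReal c * f (t₀, x) = ENNReal.ofReal c * ∫⁻ t₀ in I, ∫⁻ x, f (t₀, x) := by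
  rw [← lintegral_const_mul' _ _ ENNReal.ofReal_ne_top]
  exact lintegral_congr fun t₀ => lintegral_const_mul' _ _ ENNReal.ofReal_ne_top

/-- From a bound in `ℝ≥0∞` on the extended norm to a bound on the absolute value. [folklore] -/
theorem abs_le_of_enorm_le {x B : ℝ} (hB : 0 ≤ B) (h : ‖x‖ₑ ≤ ENNReal.ofReal B) : |x| ≤ B := by
  rw [Real.enorm_eq_ofReal_abs] at h
  exact (ENNReal.ofReal_le_ofReal_iff hB).1 h

/-! ## §2 The deterministic core along one trajectory -/

set_option maxHeartbeats 1600000 in -- one declaration: the huge window-covariance literals of six majorants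
/-- **THE DETERMINISTIC CORE ALONG ONE HARD-SPHERE TRAJECTORY** (see the module docstring). [folklore] -/
theorem windows_integral_le {ε : ℝ} (hε : 0 ≤ ε) {γ : ℝ → Phase N}
    (h : IsHardSphereTrajectory (Torus.geometry (Fin 3)) ε (N + 1) γ) {r : ℝ} (hr : 0 < r) (hr2 : r < 1 / 2)
    {τ t : ℝ} (ht : 0 ≤ t) (htτ : t ≤ τ) {V : ℝ} (hV : 0 < V) {σ : ℝ} (hσ : 0 ≤ σ)
    (a : Fin 3 → Fin 3 → ℝ × T3 → ℝ) (hac : ∀ j k, Continuous (a j k)) (htr : ∀ p, ∑ j, a j j p = 0)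
    {A : ℝ} (hA : ∀ j k, ∀ s ∈ Icc 0 τ, ∀ x, |a j k (s, x)| ≤ A)
    {κa : ℝ} (hκa0 : 0 ≤ κa)
    (hκa : ∀ j k, ∀ s ∈ Icc 0 τ, ∀ t₀ ∈ Icc 0 τ, ∀ x : T3, |s - t₀| ≤ r ^ 2 → |a j k (s, x) - a j k (t₀, x)| ≤ κa)
    (g : ℝ → ℝ) (hgc : Continuous g) {Gb : ℝ} (hGb : ∀ b, 0 ≤ b → |g b| ≤ Gb)
    {κg lam : ℝ} (hlam : 0 < lam) (hκg0 : 0 ≤ κg) (hκg : ∀ b b', 0 ≤ b → 0 ≤ b' → |b - b'| < lam → |g b - g b'| ≤ κg)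
    {Rcap : ℝ} (hcap : ∀ s ∈ Icc 0 τ, ∀ x : T3, rhoC r (γ s) x ≤ Rcap) :
    |∫ t₀ in Icc (r ^ 2) (t - r ^ 2), ∫ x : T3, ∫ s in Icc 0 τ, (r ^ 2)⁻¹ * max (1 - |s - t₀| / r ^ 2) 0 * (g (σ ^ 3 * rhoC r (γ s) x) * ∑ j, ∑ k, a j k (s, x) * (MpsiC r (γ s) x (fun v => v j * v k) - momC r (γ s) x j * momC r (γ s) x k / rhoC r (γ s) x))| ≤
      A * ((∫ t₀ in Icc 0 τ, ∫ x, max (g (σ ^ 3 * ∫ s in Icc 0 τ, (r ^ 2)⁻¹ * max (1 - |s - t₀| / r ^ 2) 0 * rhoC r (γ s) x)) 0 * ∑ j : Fin 3, ∑ k : Fin 3, |((∫ s in Icc 0 τ, (r ^ 2)⁻¹ * max (1 - |s - t₀| / r ^ 2) 0 * MpsiC r (γ s) x (fun v => v j * v k)) - (∫ s in Icc 0 τ, (r ^ 2)⁻¹ * max (1 - |s - t₀| / r ^ 2) 0 * MpsiC r (γ s) x (fun v => v j)) * (∫ s in Icc 0 τ, (r ^ 2)⁻¹ * max (1 - |s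 - t₀| / r ^ 2) 0 * MpsiC r (γ s) x (fun v => v k)) / (∫ s in Icc 0 τ, (r ^ 2)⁻¹ * max (1 - |s - t₀| / r ^ 2) 0 * rhoC r (γ s) x)) - if j = k then (∑ l, ((∫ s in Icc 0 τ, (r ^ 2)⁻¹ * max (1 - |s - t₀| / r ^ 2) 0 * MpsiC r (γ s) x (fun v => v l * v l)) - (∫ s in Icc 0 τ, (r ^ 2)⁻¹ * max (1 - |s - t₀| / r ^ 2) 0 * MpsiC r (γ s) x (fun v => v l)) * (∫ s in Icc 0 τ, (r ^ 2)⁻¹ * max (1 - |s - t₀| / r ^ 2) 0 * MpsiC r (γ s) x (fun v => v l)) / (∫ s in Icc 0 τ, (r ^ 2)⁻¹ * max (1 - |s - t₀| / r ^ 2) 0 * rhoC r (γ s) x))) / 3 else 0|) + (∫ t₀ in Icc 0 τ, ∫ x, max (-g (σ ^ 3 * ∫ s in Icc 0 τ, (r ^ 2)⁻¹ * max (1 - |s - t₀| / r ^ 2) 0 * rhoC r (γ s) x)) 0 * ∑ j : Fin 3, ∑ k : Fin 3, |((∫ s in Icc 0 τ, (r ^ 2)⁻¹ * max (1 - |s -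 t₀| / r ^ 2) 0 * MpsiC r (γ s) x (fun v => v j * v k)) - (∫ s in Icc 0 τ, (r ^ 2)⁻¹ * max (1 - |s - t₀| / r ^ 2) 0 * MpsiC r (γ s) x (fun v => v j)) * (∫ s in Icc 0 τ, (r ^ 2)⁻¹ * max (1 - |s - t₀| / r ^ 2) 0 * MpsiC r (γ s) x (fun v => v k)) / (∫ s in Icc 0 τ, (r ^ 2)⁻¹ * max (1 - |s - t₀| / r ^ 2) 0 * rhoC r (γ s) x)) - if j = k then (∑ l, ((∫ s in Icc 0 τ, (r ^ 2)⁻¹ * max (1 - |s - t₀| / r ^ 2) 0 * MpsiC r (γ s) x (fun v => v l * v l)) - (∫ s in Icc 0 τ, (r ^ 2)⁻¹ * max (1 - |s - t₀| / r ^ 2) 0 * MpsiC r (γ s) x (fun v => v l)) * (∫ s in Icc 0 τ, (r ^ 2)⁻¹ * max (1 - |s - t₀| / r ^ 2) 0 * MpsiC r (γ s) x (fun v => v l)) / (∫ s in Icc 0 τ, (r ^ 2)⁻¹ * max (1 - |s - t₀| / r ^ 2) 0 * rhoC r (γ s) x))) / 3 else 0|)) + Gb * (3 * A * (4 * V * (16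 * ke (γ 0) * r * τ + ((N + 1 : ℕ) : ℝ)⁻¹ * (8 * ε * r) * collisionalTransferFunctional (Torus.geometry (Fin 3)) ε (fun i _ pre post => ‖(post i).2 - (pre i).2‖) γ 0 τ) + 4 * V ^ 2 * (8 * r * (1 / 2 + ke (γ 0)) * τ) + 6 * (∫ s in Icc 0 τ, ((N + 1 : ℕ) : ℝ)⁻¹ * ∑ i, sqTail V (γ s i).2) + 4 * (∫ s in Icc 0 τ, ((N + 1 : ℕ) : ℝ)⁻¹ * ∑ i, sqTail V (γ s i).2))) + 30 * (Gb * κa + A * κg) * (ke (γ 0) * τ) + Gb * A * σ ^ 3 * Rcap / lam * (60 * V ^ 2 * (8 * r * (1 / 2 + ke (γ 0)) * τ) + 30 * (∫ s in Icc 0 τ, ((N + 1 : ℕ) : ℝ)⁻¹ * ∑ i, sqTail V (γ s i).2)) := by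
  have hγ := h.measurable_torus
  have hK : ∀ s, ke (γ s) ≤ ke (γ 0) := ke_le_init h
  have hK0 : 0 ≤ ke (γ 0) := ke_nonneg _
  have hh : 0 < r ^ 2 := by positivity
  have hGb0 : 0 ≤ Gb := (abs_nonneg _).trans (hGb 0 le_rfl)
  have hτ0 : 0 ≤ τ := ht.trans htτ
  have h0mem : (0 : ℝ) ∈ Icc 0 τ := ⟨le_rfl, hτ0⟩
  have hA0 : 0 ≤ A := (abs_nonneg _).trans (hA 0 0 0 h0mem 0)
  have hRcap0 : 0 ≤ Rcap := (rhoC_nonneg hr _ _).trans (hcap 0 h0mem 0)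
  have hIτ : Icc (r ^ 2) (t - r ^ 2) ⊆ Icc 0 τ := windows_subset r htτ
  have hpt : ∀ t₀ ∈ Icc (r ^ 2) (t - r ^ 2), ∀ x : T3, |∫ s in Icc 0 τ, (r ^ 2)⁻¹ * max (1 - |s - t₀| / r ^ 2) 0 * (g (σ ^ 3 * rhoC r (γ s) x) * ∑ j, ∑ k, a j k (s, x) * (MpsiC r (γ s) x (fun v => v j * v k) - momC r (γ s) x j * momC r (γ s) x k / rhoC r (γ s) x))| ≤ |g (σ ^ 3 * ∫ s in Icc 0 τ, (r ^ 2)⁻¹ * max (1 - |s - t₀| / r ^ 2) 0 * rhoC r (γ s) x)| * (A * ∑ j : Fin 3, ∑ k : Fin 3, |((∫ s in Icc 0 τ, (r ^ 2)⁻¹ * max (1 - |s - t₀| / r ^ 2) 0 * MpsiC r (γ s) x (fun v => v j * v k)) - (∫ s in Icc 0 τ, (r ^ 2)⁻¹ * max (1 - |s - t₀| / r ^ 2) 0 * MpsiC r (γ s) x (fun v => v j)) * (∫ s in Icc 0 τ, (r ^ 2)⁻¹ * max (1 - |s - t₀| / r ^ 2) 0 * MpsiC r (γ s) x (fun v =>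 v k)) / (∫ s in Icc 0 τ, (r ^ 2)⁻¹ * max (1 - |s - t₀| / r ^ 2) 0 * rhoC r (γ s) x)) - if j = k then (∑ l, ((∫ s in Icc 0 τ, (r ^ 2)⁻¹ * max (1 - |s - t₀| / r ^ 2) 0 * MpsiC r (γ s) x (fun v => v l * v l)) - (∫ s in Icc 0 τ, (r ^ 2)⁻¹ * max (1 - |s - t₀| / r ^ 2) 0 * MpsiC r (γ s) x (fun v => v l)) * (∫ s in Icc 0 τ, (r ^ 2)⁻¹ * max (1 - |s - t₀| / r ^ 2) 0 * MpsiC r (γ s) x (fun v => v l)) / (∫ s in Icc 0 τ, (r ^ 2)⁻¹ * max (1 - |s - t₀| / r ^ 2) 0 * rhoC r (γ s) x))) / 3 else 0|) + Gb * (3 * A * (4 * V * (∫ s in Icc 0 τ, (r ^ 2)⁻¹ * max (1 - |s - t₀| / r ^ 2) 0 * ‖momC r (γ s) x - momC r (γ t₀) x‖) + 4 * V ^ 2 * (∫ s in Icc 0 τ, (r ^ 2)⁻¹ * max (1 - |s - t₀| / r ^ 2) 0 * |rhoC r (γ s) x - rhoC r (γ t₀) x|) + 6 * (∫ s in Icc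 0 τ, (r ^ 2)⁻¹ * max (1 - |s - t₀| / r ^ 2) 0 * MpsiC r (γ s) x (sqTail V)) + 4 * MpsiC r (γ t₀) x (sqTail V))) + 30 * (Gb * κa + A * κg) * (∫ s in Icc 0 τ, (r ^ 2)⁻¹ * max (1 - |s - t₀| / r ^ 2) 0 * kinC r (γ s) x) + Gb * A * σ ^ 3 * Rcap / lam * (60 * V ^ 2 * (∫ s in Icc 0 τ, (r ^ 2)⁻¹ * max (1 - |s - t₀| / r ^ 2) 0 * |rhoC r (γ s) x - rhoC r (γ t₀) x|) + 30 * (∫ s in Icc 0 τ, (r ^ 2)⁻¹ * max (1 - |s - t₀| / r ^ 2) 0 * MpsiC r (γ s) x (sqTail V))) := by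
    intro t₀ ht₀ x
    have ht₀τ : t₀ + r ^ 2 ≤ τ := by linarith [ht₀.2]
    have ht₀mem : t₀ ∈ Icc 0 τ := hIτ ht₀
    exact window_estimate hγ hK hr hr2 ht₀.1 ht₀τ x hV hσ a hac (htr (t₀, x)) (fun j k s hs => hA j k s hs x)
      (fun j k s hs hst => hκa j k s hs t₀ ht₀mem x hst) g hgc hGb hlam hκg0 hκg (fun s hs => hcap s hs x)
  -- ### the six majorants as functions of the window, their measurability and nonnegativity
  set F1 : ℝ × T3 → ℝ≥0∞ := fun p => ENNReal.ofReal (|g (σ ^ 3 * ∫ s in Icc 0 τ, (r ^ 2)⁻¹ * max (1 - |s - p.1| / r ^ 2) 0 * rhoC r (γ s) p.2)| * (A * ∑ j : Fin 3, ∑ k : Fin 3, |((∫ s in Icc 0 τ, (r ^ 2)⁻¹ * max (1 - |s - p.1| / r ^ 2) 0 * MpsiC r (γ s) p.2 (fun v => v j * v k)) - (∫ s in Icc 0 τ, (r ^ 2)⁻¹ * max (1 - |s - p.1| / r ^ 2) 0 * MpsiC r (γ s) p.2 (fun v => v j)) * (∫ s in Icc 0 τ, (r ^ 2)⁻¹ *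 max (1 - |s - p.1| / r ^ 2) 0 * MpsiC r (γ s) p.2 (fun v => v k)) / (∫ s in Icc 0 τ, (r ^ 2)⁻¹ * max (1 - |s - p.1| / r ^ 2) 0 * rhoC r (γ s) p.2)) - if j = k then (∑ l, ((∫ s in Icc 0 τ, (r ^ 2)⁻¹ * max (1 - |s - p.1| / r ^ 2) 0 * MpsiC r (γ s) p.2 (fun v => v l * v l)) - (∫ s in Icc 0 τ, (r ^ 2)⁻¹ * max (1 - |s - p.1| / r ^ 2) 0 * MpsiC r (γ s) p.2 (fun v => v l)) * (∫ s in Icc 0 τ, (r ^ 2)⁻¹ * max (1 - |s - p.1| / r ^ 2) 0 * MpsiC r (γ s) p.2 (fun v => v l)) / (∫ s in Icc 0 τ, (r ^ 2)⁻¹ * max (1 - |s - p.1| / r ^ 2) 0 * rhoC r (γ s) p.2))) / 3 else 0|)) with hF1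
  set Fm : ℝ × T3 → ℝ≥0∞ := fun p => ENNReal.ofReal (∫ s in Icc 0 τ, (r ^ 2)⁻¹ * max (1 - |s - p.1| / r ^ 2) 0 * ‖momC r (γ s) p.2 - momC r (γ p.1) p.2‖) with hFm
  set Fr : ℝ × T3 → ℝ≥0∞ := fun p => ENNReal.ofReal (∫ s in Icc 0 τ, (r ^ 2)⁻¹ * max (1 - |s - p.1| / r ^ 2) 0 * |rhoC r (γ s) p.2 - rhoC r (γ p.1) p.2|) with hFr
  set FT : ℝ × T3 → ℝ≥0∞ := fun p => ENNReal.ofReal (∫ s in Icc 0 τ, (r ^ 2)⁻¹ * max (1 - |s - p.1| / r ^ 2) 0 * MpsiC r (γ s) p.2 (sqTail V)) with hFT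
  set F0 : ℝ × T3 → ℝ≥0∞ := fun p => ENNReal.ofReal (MpsiC r (γ p.1) p.2 (sqTail V)) with hF0
  set Fe : ℝ × T3 → ℝ≥0∞ := fun p => ENNReal.ofReal (∫ s in Icc 0 τ, (r ^ 2)⁻¹ * max (1 - |s - p.1| / r ^ 2) 0 * kinC r (γ s) p.2) with hFe
  have hFm_m : Measurable Fm := (measurable_momIncrementW hγ r τ).ennreal_ofReal
  have hFr_m : Measurable Fr := (measurable_rhoIncrementW hγ r τ).ennreal_ofReal
  have hFT_m : Measurable FT := (measurable_MpsiCW hγ r τ (measurable_sqTail V)).ennreal_ofReal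
  have hF0_m : Measurable F0 := (measurable_MpsiC_orbit hγ r (measurable_sqTail V)).ennreal_ofReal
  have hF1_m : Measurable F1 :=
    (((hgc.measurable.comp ((measurable_rhoW hγ r τ).const_mul _)).abs).mul ((measurable_dev hγ r τ).const_mul _)).ennreal_ofReal
  set cm : ℝ := Gb * (3 * A) * (4 * V) with hcm
  set cr : ℝ := Gb * (3 * A) * (4 * V ^ 2) + Gb * A * σ ^ 3 * Rcap / lam * (60 * V ^ 2) with hcr
  set cT : ℝ := Gb * (3 * A) * 6 + Gb * A * σ ^ 3 * Rcap / lam * 30 with hcT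
  set c0 : ℝ := Gb * (3 * A) * 4 with hc0
  set ce : ℝ := 30 * (Gb * κa + A * κg) with hce
  have hcm0 : 0 ≤ cm := by positivity
  have hcr0 : 0 ≤ cr := by positivity
  have hcT0 : 0 ≤ cT := by positivity
  have hc00 : 0 ≤ c0 := by positivity
  have hce0 : 0 ≤ ce := by positivity
  have hw0 : ∀ a : ℝ, 0 ≤ (r ^ 2)⁻¹ * max (1 - |a| / r ^ 2) 0 := fun a => (tent_nonneg_le hh a).1
  have hsplit : ∀ t₀ x, ENNReal.ofReal (|g (σ ^ 3 * ∫ s in Icc 0 τ, (r ^ 2)⁻¹ * max (1 - |s - t₀| / r ^ 2) 0 * rhoC r (γ s) x)| * (A * ∑ j : Fin 3, ∑ k : Fin 3, |((∫ s in Icc 0 τ, (r ^ 2)⁻¹ * max (1 - |s - t₀| / r ^ 2) 0 * MpsiC r (γ s) x (fun v => v j * v k)) - (∫ s in Icc 0 τ, (r ^ 2)⁻¹ * max (1 - |s - t₀| / r ^ 2) 0 * MpsiC r (γ s) x (fun v => v j)) * (∫ s in Icc 0 τ, (r ^ 2)⁻¹ * max (1 - |s - t₀| / r ^ 2) 0 *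 MpsiC r (γ s) x (fun v => v k)) / (∫ s in Icc 0 τ, (r ^ 2)⁻¹ * max (1 - |s - t₀| / r ^ 2) 0 * rhoC r (γ s) x)) - if j = k then (∑ l, ((∫ s in Icc 0 τ, (r ^ 2)⁻¹ * max (1 - |s - t₀| / r ^ 2) 0 * MpsiC r (γ s) x (fun v => v l * v l)) - (∫ s in Icc 0 τ, (r ^ 2)⁻¹ * max (1 - |s - t₀| / r ^ 2) 0 * MpsiC r (γ s) x (fun v => v l)) * (∫ s in Icc 0 τ, (r ^ 2)⁻¹ * max (1 - |s - t₀| / r ^ 2) 0 * MpsiC r (γ s) x (fun v => v l)) / (∫ s in Icc 0 τ, (r ^ 2)⁻¹ * max (1 - |s - t₀| / r ^ 2) 0 * rhoC r (γ s) x))) / 3 else 0|) + Gb * (3 * A * (4 * V * (∫ s in Icc 0 τ, (r ^ 2)⁻¹ * max (1 - |s - t₀| / r ^ 2) 0 * ‖momC r (γ s) x - momC r (γ t₀) x‖) + 4 * V ^ 2 * (∫ s in Icc 0 τ, (r ^ 2)⁻¹ * max (1 - |s - t₀| / r ^ 2) 0 * |rhoC r (γ s) x - rhoC r (γ t₀)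 x|) + 6 * (∫ s in Icc 0 τ, (r ^ 2)⁻¹ * max (1 - |s - t₀| / r ^ 2) 0 * MpsiC r (γ s) x (sqTail V)) + 4 * MpsiC r (γ t₀) x (sqTail V))) + 30 * (Gb * κa + A * κg) * (∫ s in Icc 0 τ, (r ^ 2)⁻¹ * max (1 - |s - t₀| / r ^ 2) 0 * kinC r (γ s) x) + Gb * A * σ ^ 3 * Rcap / lam * (60 * V ^ 2 * (∫ s in Icc 0 τ, (r ^ 2)⁻¹ * max (1 - |s - t₀| / r ^ 2) 0 * |rhoC r (γ s) x - rhoC r (γ t₀) x|) + 30 * (∫ s in Icc 0 τ, (r ^ 2)⁻¹ * max (1 - |s - t₀| / r ^ 2) 0 * MpsiC r (γ s) x (sqTail V)))) =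
      F1 (t₀, x) + (ENNReal.ofReal cm * Fm (t₀, x) + (ENNReal.ofReal cr * Fr (t₀, x) + (ENNReal.ofReal cT * FT (t₀, x) +
        (ENNReal.ofReal c0 * F0 (t₀, x) + ENNReal.ofReal ce * Fe (t₀, x))))) := by
    intro t₀ x
    have hDm0 : 0 ≤ ∫ s in Icc 0 τ, (r ^ 2)⁻¹ * max (1 - |s - t₀| / r ^ 2) 0 * ‖momC r (γ s) x - momC r (γ t₀) x‖ := integral_nonneg fun s => mul_nonneg (hw0 _) (norm_nonneg _)
    have hDr0 : 0 ≤ ∫ s in Icc 0 τ, (r ^ 2)⁻¹ * max (1 - |s - t₀| / r ^ 2) 0 * |rhoC r (γ s) x - rhoC r (γ t₀) x| := integral_nonneg fun s => mul_nonneg (hw0 _) (abs_nonneg _)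
    have hTw0 : 0 ≤ ∫ s in Icc 0 τ, (r ^ 2)⁻¹ * max (1 - |s - t₀| / r ^ 2) 0 * MpsiC r (γ s) x (sqTail V) := integral_nonneg fun s => mul_nonneg (hw0 _) ((MpsiC_sqTail_le hr _ _ V).1)
    have hT00 : 0 ≤ MpsiC r (γ t₀) x (sqTail V) := (MpsiC_sqTail_le hr _ _ V).1
    have hEw0 : 0 ≤ ∫ s in Icc 0 τ, (r ^ 2)⁻¹ * max (1 - |s - t₀| / r ^ 2) 0 * kinC r (γ s) x := integral_nonneg fun s => mul_nonneg (hw0 _) (kinC_nonneg hr _ _)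
    have hP10 : 0 ≤ |g (σ ^ 3 * ∫ s in Icc 0 τ, (r ^ 2)⁻¹ * max (1 - |s - t₀| / r ^ 2) 0 * rhoC r (γ s) x)| * (A * ∑ j : Fin 3, ∑ k : Fin 3, |((∫ s in Icc 0 τ, (r ^ 2)⁻¹ * max (1 - |s - t₀| / r ^ 2) 0 * MpsiC r (γ s) x (fun v => v j * v k)) - (∫ s in Icc 0 τ, (r ^ 2)⁻¹ * max (1 - |s - t₀| / r ^ 2) 0 * MpsiC r (γ s) x (fun v => v j)) * (∫ s in Icc 0 τ, (r ^ 2)⁻¹ * max (1 - |s - t₀| / r ^ 2) 0 * MpsiC r (γ s) x (fun v => v k)) / (∫ s in Icc 0 τ, (r ^ 2)⁻¹ * max (1 - |s - t₀| / r ^ 2) 0 * rhoC r (γ s) x)) - if j = k then (∑ l, ((∫ s in Icc 0 τ, (r ^ 2)⁻¹ * max (1 - |s - t₀| / r ^ 2) 0 * MpsiC r (γ s) x (fun v => v l * v l)) - (∫ s in Icc 0 τ, (r ^ 2)⁻¹ * max (1 - |s - t₀| / r ^ 2) 0 * MpsiC r (γ s) x (fun v => v l)) * (∫ s in Icc 0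 τ, (r ^ 2)⁻¹ * max (1 - |s - t₀| / r ^ 2) 0 * MpsiC r (γ s) x (fun v => v l)) / (∫ s in Icc 0 τ, (r ^ 2)⁻¹ * max (1 - |s - t₀| / r ^ 2) 0 * rhoC r (γ s) x))) / 3 else 0|) :=
      mul_nonneg (abs_nonneg _) (mul_nonneg hA0 (Finset.sum_nonneg fun j _ => Finset.sum_nonneg fun k _ => abs_nonneg _))
    simp only [hF1, hFm, hFr, hFT, hF0, hFe]
    rw [← ENNReal.ofReal_mul hcm0, ← ENNReal.ofReal_mul hcr0, ← ENNReal.ofReal_mul hcT0, ← ENNReal.ofReal_mul hc00,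
      ← ENNReal.ofReal_mul hce0,
      ← ENNReal.ofReal_add (mul_nonneg hc00 hT00) (mul_nonneg hce0 hEw0),
      ← ENNReal.ofReal_add (mul_nonneg hcT0 hTw0) (add_nonneg (mul_nonneg hc00 hT00) (mul_nonneg hce0 hEw0)),
      ← ENNReal.ofReal_add (mul_nonneg hcr0 hDr0) (add_nonneg (mul_nonneg hcT0 hTw0) (add_nonneg (mul_nonneg hc00 hT00) (mul_nonneg hce0 hEw0))),
      ← ENNReal.ofReal_add (mul_nonneg hcm0 hDm0) (add_nonneg (mul_nonneg hcr0 hDr0) (add_nonneg (mul_nonneg hcT0 hTw0) (add_nonneg (mul_nonneg hc00 hT00) (mul_nonneg hce0 hEw0)))),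
      ← ENNReal.ofReal_add hP10 (add_nonneg (mul_nonneg hcm0 hDm0) (add_nonneg (mul_nonneg hcr0 hDr0) (add_nonneg (mul_nonneg hcT0 hTw0) (add_nonneg (mul_nonneg hc00 hT00) (mul_nonneg hce0 hEw0)))))]
    congr 1
    simp only [hcm, hcr, hcT, hc0, hce]
    ring
  -- ### from the Bochner double integral to the double Lebesgue integral of the majorant
  have hstep : ‖∫ t₀ in Icc (r ^ 2) (t - r ^ 2), ∫ x : T3, ∫ s in Icc 0 τ, (r ^ 2)⁻¹ * max (1 - |s - t₀| / r ^ 2) 0 * (g (σ ^ 3 * rhoC r (γ s) x) * ∑ j, ∑ k, a j k (s, x) * (MpsiC r (γ s) x (fun v => v j * v k) - momC r (γ s) x j * momC r (γ s) x k / rhoC r (γ s) x))‖ₑ ≤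
      ∫⁻ t₀ in Icc (r ^ 2) (t - r ^ 2), ∫⁻ x : T3, (F1 (t₀, x) + (ENNReal.ofReal cm * Fm (t₀, x) +
        (ENNReal.ofReal cr * Fr (t₀, x) + (ENNReal.ofReal cT * FT (t₀, x) + (ENNReal.ofReal c0 * F0 (t₀, x) + ENNReal.ofReal ce * Fe (t₀, x)))))) := by
    refine (enorm_integral_le_lintegral_enorm _).trans (setLIntegral_mono' measurableSet_Icc fun t₀ ht₀ => ?_)
    refine (enorm_integral_le_lintegral_enorm _).trans (lintegral_mono fun x => ?_)
    rw [← hsplit t₀ x, Real.enorm_eq_ofReal_abs]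
    exact ENNReal.ofReal_le_ofReal (hpt t₀ ht₀ x)
  have hI1 := lintegral_devTerm_le hγ hK hr τ hσ g hgc hGb hA0 hIτ
  have hIm := lintegral_momIncrement_le hε h hr hr2 ht htτ
  have hIr := lintegral_rhoIncrement_le h hr hr2 (τ := τ) htτ
  have hIT := lintegral_tailW_le h hr hr2 τ V (Icc (r ^ 2) (t - r ^ 2))
  have hI0 := lintegral_tail0_le h hr hr2 htτ V
  have hIe := lintegral_kinW_le h hr hr2 hτ0 (Icc (r ^ 2) (t - r ^ 2))
  have hTail0 : 0 ≤ ∫ s in Icc 0 τ, ((N + 1 : ℕ) : ℝ)⁻¹ * ∑ i, sqTail V (γ s i).2 :=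
    integral_nonneg fun s => mul_nonneg (by positivity) (Finset.sum_nonneg fun i _ => sqTail_nonneg V _)
  have hS0 : 0 ≤ collisionalTransferFunctional (Torus.geometry (Fin 3)) ε (fun i _ pre post => ‖(post i).2 - (pre i).2‖) γ 0 τ := ctf_nonneg (fun _ _ _ _ => norm_nonneg _) 0 τ
  have hBm0 : 0 ≤ (16 * ke (γ 0) * r * τ + ((N + 1 : ℕ) : ℝ)⁻¹ * (8 * ε * r) * collisionalTransferFunctional (Torus.geometry (Fin 3)) ε (fun i _ pre post => ‖(post i).2 - (pre i).2‖) γ 0 τ) := by positivity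
  have hBr0 : 0 ≤ (8 * r * (1 / 2 + ke (γ 0)) * τ) := by positivity
  have hDp0 : 0 ≤ ∫ t₀ in Icc 0 τ, ∫ x, max (g (σ ^ 3 * ∫ s in Icc 0 τ, (r ^ 2)⁻¹ * max (1 - |s - t₀| / r ^ 2) 0 * rhoC r (γ s) x)) 0 * ∑ j : Fin 3, ∑ k : Fin 3, |((∫ s in Icc 0 τ, (r ^ 2)⁻¹ * max (1 - |s - t₀| / r ^ 2) 0 * MpsiC r (γ s) x (fun v => v j * v k)) - (∫ s in Icc 0 τ, (r ^ 2)⁻¹ * max (1 - |s - t₀| / r ^ 2) 0 * MpsiC r (γ s) x (fun v => v j)) * (∫ s in Icc 0 τ, (r ^ 2)⁻¹ * max (1 - |s - t₀| / r ^ 2) 0 * MpsiC r (γ s) x (fun v => v k)) / (∫ s in Icc 0 τ, (r ^ 2)⁻¹ * max (1 - |s - t₀| / r ^ 2) 0 * rhoC r (γ s) x)) - if j = k then (∑ l, ((∫ s in Icc 0 τ, (r ^ 2)⁻¹ * max (1 - |s - t₀| / r ^ 2) 0 * MpsiC r (γ s) x (fun v => v l * v l)) - (∫ s in Icc 0 τ,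 (r ^ 2)⁻¹ * max (1 - |s - t₀| / r ^ 2) 0 * MpsiC r (γ s) x (fun v => v l)) * (∫ s in Icc 0 τ, (r ^ 2)⁻¹ * max (1 - |s - t₀| / r ^ 2) 0 * MpsiC r (γ s) x (fun v => v l)) / (∫ s in Icc 0 τ, (r ^ 2)⁻¹ * max (1 - |s - t₀| / r ^ 2) 0 * rhoC r (γ s) x))) / 3 else 0| := integral_nonneg fun t₀ => integral_nonneg fun x =>
    mul_nonneg (le_max_right _ _) (Finset.sum_nonneg fun j _ => Finset.sum_nonneg fun k _ => abs_nonneg _)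
  have hDm0' : 0 ≤ ∫ t₀ in Icc 0 τ, ∫ x, max (-g (σ ^ 3 * ∫ s in Icc 0 τ, (r ^ 2)⁻¹ * max (1 - |s - t₀| / r ^ 2) 0 * rhoC r (γ s) x)) 0 * ∑ j : Fin 3, ∑ k : Fin 3, |((∫ s in Icc 0 τ, (r ^ 2)⁻¹ * max (1 - |s - t₀| / r ^ 2) 0 * MpsiC r (γ s) x (fun v => v j * v k)) - (∫ s in Icc 0 τ, (r ^ 2)⁻¹ * max (1 - |s - t₀| / r ^ 2) 0 * MpsiC r (γ s) x (fun v => v j)) * (∫ s in Icc 0 τ, (r ^ 2)⁻¹ * max (1 - |s - t₀| / r ^ 2) 0 * MpsiC r (γ s) x (fun v => v k)) / (∫ s in Icc 0 τ, (r ^ 2)⁻¹ * max (1 - |s - t₀| / r ^ 2) 0 * rhoC r (γ s) x)) - if j = k then (∑ l, ((∫ s in Icc 0 τ, (r ^ 2)⁻¹ * max (1 - |s - t₀| / r ^ 2) 0 * MpsiC r (γ s) x (fun v => v l * v l)) - (∫ s in Icc 0 τ, (r ^ 2)⁻¹ * max (1 - |s - t₀| / r ^ 2) 0 * MpsiC r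 (γ s) x (fun v => v l)) * (∫ s in Icc 0 τ, (r ^ 2)⁻¹ * max (1 - |s - t₀| / r ^ 2) 0 * MpsiC r (γ s) x (fun v => v l)) / (∫ s in Icc 0 τ, (r ^ 2)⁻¹ * max (1 - |s - t₀| / r ^ 2) 0 * rhoC r (γ s) x))) / 3 else 0| := integral_nonneg fun t₀ => integral_nonneg fun x =>
    mul_nonneg (le_max_right _ _) (Finset.sum_nonneg fun j _ => Finset.sum_nonneg fun k _ => abs_nonneg _)
  have htotal : ∫⁻ t₀ in Icc (r ^ 2) (t - r ^ 2), ∫⁻ x : T3, (F1 (t₀, x) + (ENNReal.ofReal cm * Fm (t₀, x) +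
        (ENNReal.ofReal cr * Fr (t₀, x) + (ENNReal.ofReal cT * FT (t₀, x) + (ENNReal.ofReal c0 * F0 (t₀, x) + ENNReal.ofReal ce * Fe (t₀, x)))))) ≤
      ENNReal.ofReal (A * ((∫ t₀ in Icc 0 τ, ∫ x, max (g (σ ^ 3 * ∫ s in Icc 0 τ, (r ^ 2)⁻¹ * max (1 - |s - t₀| / r ^ 2) 0 * rhoC r (γ s) x)) 0 * ∑ j : Fin 3, ∑ k : Fin 3, |((∫ s in Icc 0 τ, (r ^ 2)⁻¹ * max (1 - |s - t₀| / r ^ 2) 0 * MpsiC r (γ s) x (fun v => v j * v k)) - (∫ s in Icc 0 τ, (r ^ 2)⁻¹ * max (1 - |s - t₀| / r ^ 2) 0 * MpsiC r (γ s) x (fun v => v j)) * (∫ s in Icc 0 τ, (r ^ 2)⁻¹ * max (1 - |s - t₀| / r ^ 2) 0 * MpsiC r (γ s) x (fun v => v k)) / (∫ s in Icc 0 τ, (r ^ 2)⁻¹ * max (1 - |s - t₀| / r ^ 2) 0 * rhoC r (γ s) x)) - if j = k then (∑ l, ((∫ s in Icc 0 τ, (r ^ 2)⁻¹ * max (1 -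 |s - t₀| / r ^ 2) 0 * MpsiC r (γ s) x (fun v => v l * v l)) - (∫ s in Icc 0 τ, (r ^ 2)⁻¹ * max (1 - |s - t₀| / r ^ 2) 0 * MpsiC r (γ s) x (fun v => v l)) * (∫ s in Icc 0 τ, (r ^ 2)⁻¹ * max (1 - |s - t₀| / r ^ 2) 0 * MpsiC r (γ s) x (fun v => v l)) / (∫ s in Icc 0 τ, (r ^ 2)⁻¹ * max (1 - |s - t₀| / r ^ 2) 0 * rhoC r (γ s) x))) / 3 else 0|) + (∫ t₀ in Icc 0 τ, ∫ x, max (-g (σ ^ 3 * ∫ s in Icc 0 τ, (r ^ 2)⁻¹ * max (1 - |s - t₀| / r ^ 2) 0 * rhoC r (γ s) x)) 0 * ∑ j : Fin 3, ∑ k : Fin 3, |((∫ s in Icc 0 τ, (r ^ 2)⁻¹ * max (1 - |s - t₀| / r ^ 2) 0 * MpsiC r (γ s) x (fun v => v j * v k)) - (∫ s in Icc 0 τ, (r ^ 2)⁻¹ * max (1 - |s - t₀| / r ^ 2) 0 * MpsiC r (γ s) x (fun v => v j)) * (∫ s in Icc 0 τ, (r ^ 2)⁻¹ * max (1 - |s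 - t₀| / r ^ 2) 0 * MpsiC r (γ s) x (fun v => v k)) / (∫ s in Icc 0 τ, (r ^ 2)⁻¹ * max (1 - |s - t₀| / r ^ 2) 0 * rhoC r (γ s) x)) - if j = k then (∑ l, ((∫ s in Icc 0 τ, (r ^ 2)⁻¹ * max (1 - |s - t₀| / r ^ 2) 0 * MpsiC r (γ s) x (fun v => v l * v l)) - (∫ s in Icc 0 τ, (r ^ 2)⁻¹ * max (1 - |s - t₀| / r ^ 2) 0 * MpsiC r (γ s) x (fun v => v l)) * (∫ s in Icc 0 τ, (r ^ 2)⁻¹ * max (1 - |s - t₀| / r ^ 2) 0 * MpsiC r (γ s) x (fun v => v l)) / (∫ s in Icc 0 τ, (r ^ 2)⁻¹ * max (1 - |s - t₀| / r ^ 2) 0 * rhoC r (γ s) x))) / 3 else 0|)) + (cm * (16 * ke (γ 0) * r * τ + ((N + 1 : ℕ) : ℝ)⁻¹ * (8 * ε * r) * collisionalTransferFunctional (Torus.geometry (Fin 3)) ε (fun i _ pre post => ‖(post i).2 - (pre i).2‖) γ 0 τ) + (cr * (8 * r * (1 / 2 + ke (γ 0)) * τ) + (cT * (∫ s in Icc 0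 τ, ((N + 1 : ℕ) : ℝ)⁻¹ * ∑ i, sqTail V (γ s i).2) + (c0 * (∫ s in Icc 0 τ, ((N + 1 : ℕ) : ℝ)⁻¹ * ∑ i, sqTail V (γ s i).2) + ce * (ke (γ 0) * τ)))))) := by
    rw [ll_add hF1_m, ll_add (hFm_m.const_mul (ENNReal.ofReal cm)), ll_add (hFr_m.const_mul (ENNReal.ofReal cr)),
      ll_add (hFT_m.const_mul (ENNReal.ofReal cT)), ll_add (hF0_m.const_mul (ENNReal.ofReal c0)), ll_const_mul Fm cm,
      ll_const_mul Fr cr, ll_const_mul FT cT, ll_const_mul F0 c0, ll_const_mul Fe ce]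
    have n1 : 0 ≤ A * ((∫ t₀ in Icc 0 τ, ∫ x, max (g (σ ^ 3 * ∫ s in Icc 0 τ, (r ^ 2)⁻¹ * max (1 - |s - t₀| / r ^ 2) 0 * rhoC r (γ s) x)) 0 * ∑ j : Fin 3, ∑ k : Fin 3, |((∫ s in Icc 0 τ, (r ^ 2)⁻¹ * max (1 - |s - t₀| / r ^ 2) 0 * MpsiC r (γ s) x (fun v => v j * v k)) - (∫ s in Icc 0 τ, (r ^ 2)⁻¹ * max (1 - |s - t₀| / r ^ 2) 0 * MpsiC r (γ s) x (fun v => v j)) * (∫ s in Icc 0 τ, (r ^ 2)⁻¹ * max (1 - |s - t₀| / r ^ 2) 0 * MpsiC r (γ s) x (fun v => v k)) / (∫ s in Icc 0 τ, (r ^ 2)⁻¹ * max (1 - |s - t₀| / r ^ 2) 0 * rhoC r (γ s) x)) - if j = k then (∑ l, ((∫ s in Icc 0 τ, (r ^ 2)⁻¹ * max (1 - |s - t₀| / r ^ 2) 0 * MpsiC r (γ s) x (fun v => v l * v l)) - (∫ s in Icc 0 τ, (r ^ 2)⁻¹ * max (1 - |s - t₀| / r ^ 2) 0 * MpsiC r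 (γ s) x (fun v => v l)) * (∫ s in Icc 0 τ, (r ^ 2)⁻¹ * max (1 - |s - t₀| / r ^ 2) 0 * MpsiC r (γ s) x (fun v => v l)) / (∫ s in Icc 0 τ, (r ^ 2)⁻¹ * max (1 - |s - t₀| / r ^ 2) 0 * rhoC r (γ s) x))) / 3 else 0|) + (∫ t₀ in Icc 0 τ, ∫ x, max (-g (σ ^ 3 * ∫ s in Icc 0 τ, (r ^ 2)⁻¹ * max (1 - |s - t₀| / r ^ 2) 0 * rhoC r (γ s) x)) 0 * ∑ j : Fin 3, ∑ k : Fin 3, |((∫ s in Icc 0 τ, (r ^ 2)⁻¹ * max (1 - |s - t₀| / r ^ 2) 0 * MpsiC r (γ s) x (fun v => v j * v k)) - (∫ s in Icc 0 τ, (r ^ 2)⁻¹ * max (1 - |s - t₀| / r ^ 2) 0 * MpsiC r (γ s) x (fun v => v j)) * (∫ s in Icc 0 τ, (r ^ 2)⁻¹ * max (1 - |s - t₀| / r ^ 2) 0 * MpsiC r (γ s) x (fun v => v k)) / (∫ s in Icc 0 τ, (r ^ 2)⁻¹ * max (1 - |s - t₀| / r ^ 2) 0 * rhoC r (γ s) x))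 - if j = k then (∑ l, ((∫ s in Icc 0 τ, (r ^ 2)⁻¹ * max (1 - |s - t₀| / r ^ 2) 0 * MpsiC r (γ s) x (fun v => v l * v l)) - (∫ s in Icc 0 τ, (r ^ 2)⁻¹ * max (1 - |s - t₀| / r ^ 2) 0 * MpsiC r (γ s) x (fun v => v l)) * (∫ s in Icc 0 τ, (r ^ 2)⁻¹ * max (1 - |s - t₀| / r ^ 2) 0 * MpsiC r (γ s) x (fun v => v l)) / (∫ s in Icc 0 τ, (r ^ 2)⁻¹ * max (1 - |s - t₀| / r ^ 2) 0 * rhoC r (γ s) x))) / 3 else 0|)) := mul_nonneg hA0 (add_nonneg hDp0 hDm0')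
    have n2 : 0 ≤ cm * (16 * ke (γ 0) * r * τ + ((N + 1 : ℕ) : ℝ)⁻¹ * (8 * ε * r) * collisionalTransferFunctional (Torus.geometry (Fin 3)) ε (fun i _ pre post => ‖(post i).2 - (pre i).2‖) γ 0 τ) := mul_nonneg hcm0 hBm0
    have n3 : 0 ≤ cr * (8 * r * (1 / 2 + ke (γ 0)) * τ) := mul_nonneg hcr0 hBr0
    have n4 : 0 ≤ cT * (∫ s in Icc 0 τ, ((N + 1 : ℕ) : ℝ)⁻¹ * ∑ i, sqTail V (γ s i).2) := mul_nonneg hcT0 hTail0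
    have n5 : 0 ≤ c0 * (∫ s in Icc 0 τ, ((N + 1 : ℕ) : ℝ)⁻¹ * ∑ i, sqTail V (γ s i).2) := mul_nonneg hc00 hTail0
    have n6 : 0 ≤ ce * (ke (γ 0) * τ) := mul_nonneg hce0 (mul_nonneg hK0 hτ0)
    rw [ENNReal.ofReal_add n1 (add_nonneg n2 (add_nonneg n3 (add_nonneg n4 (add_nonneg n5 n6)))),
      ENNReal.ofReal_add n2 (add_nonneg n3 (add_nonneg n4 (add_nonneg n5 n6))), ENNReal.ofReal_add n3 (add_nonneg n4 (add_nonneg n5 n6)),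
      ENNReal.ofReal_add n4 (add_nonneg n5 n6), ENNReal.ofReal_add n5 n6,
      ENNReal.ofReal_mul hcm0, ENNReal.ofReal_mul hcr0, ENNReal.ofReal_mul hcT0, ENNReal.ofReal_mul hc00, ENNReal.ofReal_mul hce0]
    exact add_le_add hI1 (add_le_add (mul_le_mul_right hIm _) (add_le_add (mul_le_mul_right hIr _)
      (add_le_add (mul_le_mul_right hIT _) (add_le_add (mul_le_mul_right hI0 _) (mul_le_mul_right hIe _)))))
  have hTOT0 : 0 ≤ A * ((∫ t₀ in Icc 0 τ, ∫ x, max (g (σ ^ 3 * ∫ s in Icc 0 τ, (r ^ 2)⁻¹ * max (1 - |s - t₀| / r ^ 2) 0 * rhoC r (γ s) x)) 0 * ∑ j : Fin 3, ∑ k : Fin 3, |((∫ s in Icc 0 τ, (r ^ 2)⁻¹ * max (1 - |s - t₀| / r ^ 2) 0 * MpsiC r (γ s) x (fun v => v j * v k)) - (∫ s in Icc 0 τ, (r ^ 2)⁻¹ * max (1 - |s - t₀| / r ^ 2) 0 * MpsiC r (γ s) x (fun v => v j)) * (∫ s in Icc 0 τ, (r ^ 2)⁻¹ * max (1 - |s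 - t₀| / r ^ 2) 0 * MpsiC r (γ s) x (fun v => v k)) / (∫ s in Icc 0 τ, (r ^ 2)⁻¹ * max (1 - |s - t₀| / r ^ 2) 0 * rhoC r (γ s) x)) - if j = k then (∑ l, ((∫ s in Icc 0 τ, (r ^ 2)⁻¹ * max (1 - |s - t₀| / r ^ 2) 0 * MpsiC r (γ s) x (fun v => v l * v l)) - (∫ s in Icc 0 τ, (r ^ 2)⁻¹ * max (1 - |s - t₀| / r ^ 2) 0 * MpsiC r (γ s) x (fun v => v l)) * (∫ s in Icc 0 τ, (r ^ 2)⁻¹ * max (1 - |s - t₀| / r ^ 2) 0 * MpsiC r (γ s) x (fun v => v l)) / (∫ s in Icc 0 τ, (r ^ 2)⁻¹ * max (1 - |s - t₀| / r ^ 2) 0 * rhoC r (γ s) x))) / 3 else 0|) + (∫ t₀ in Icc 0 τ, ∫ x, max (-g (σ ^ 3 * ∫ s in Icc 0 τ, (r ^ 2)⁻¹ * max (1 - |s - t₀| / r ^ 2) 0 * rhoC r (γ s) x)) 0 * ∑ j : Fin 3, ∑ k : Fin 3, |((∫ s in Icc 0 τ, (r ^ 2)⁻¹ * max (1 - |s -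 t₀| / r ^ 2) 0 * MpsiC r (γ s) x (fun v => v j * v k)) - (∫ s in Icc 0 τ, (r ^ 2)⁻¹ * max (1 - |s - t₀| / r ^ 2) 0 * MpsiC r (γ s) x (fun v => v j)) * (∫ s in Icc 0 τ, (r ^ 2)⁻¹ * max (1 - |s - t₀| / r ^ 2) 0 * MpsiC r (γ s) x (fun v => v k)) / (∫ s in Icc 0 τ, (r ^ 2)⁻¹ * max (1 - |s - t₀| / r ^ 2) 0 * rhoC r (γ s) x)) - if j = k then (∑ l, ((∫ s in Icc 0 τ, (r ^ 2)⁻¹ * max (1 - |s - t₀| / r ^ 2) 0 * MpsiC r (γ s) x (fun v => v l * v l)) - (∫ s in Icc 0 τ, (r ^ 2)⁻¹ * max (1 - |s - t₀| / r ^ 2) 0 * MpsiC r (γ s) x (fun v => v l)) * (∫ s in Icc 0 τ, (r ^ 2)⁻¹ * max (1 - |s - t₀| / r ^ 2) 0 * MpsiC r (γ s) x (fun v => v l)) / (∫ s in Icc 0 τ, (r ^ 2)⁻¹ * max (1 - |s - t₀| / r ^ 2) 0 * rhoC r (γ s) x))) / 3 else 0|)) + (cm * (16 * ke (γ 0) *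 r * τ + ((N + 1 : ℕ) : ℝ)⁻¹ * (8 * ε * r) * collisionalTransferFunctional (Torus.geometry (Fin 3)) ε (fun i _ pre post => ‖(post i).2 - (pre i).2‖) γ 0 τ) + (cr * (8 * r * (1 / 2 + ke (γ 0)) * τ) + (cT * (∫ s in Icc 0 τ, ((N + 1 : ℕ) : ℝ)⁻¹ * ∑ i, sqTail V (γ s i).2) + (c0 * (∫ s in Icc 0 τ, ((N + 1 : ℕ) : ℝ)⁻¹ * ∑ i, sqTail V (γ s i).2) + ce * (ke (γ 0) * τ))))) := by
    positivity
  have key := abs_le_of_enorm_le hTOT0 (hstep.trans htotal)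
  refine key.trans (le_of_eq ?_)
  simp only [hcm, hcr, hcT, hc0, hce]
  ring

/-! ## §3 The time profile of the functional along an orbit -/

/-- **The integrand of `WeakStressIsotropyInBand` along a measurable curve is jointly measurable in `(s, x)`.**
[folklore] -/
theorem measurable_wsiIntegrand {γ : ℝ → Phase N} (hγ : Measurable γ) (r σ : ℝ) (a : Fin 3 → Fin 3 → ℝ × T3 → ℝ)
    (hac : ∀ j k, Continuous (a j k)) (g : ℝ → ℝ) (hgc : Continuous g) :
    Measurable fun q : ℝ × T3 => g (σ ^ 3 * rhoC r (γ q.1) q.2) * ∑ j, ∑ k, a j k (q.1, q.2) *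
      (MpsiC r (γ q.1) q.2 (fun v => v j * v k) - momC r (γ q.1) q.2 j * momC r (γ q.1) q.2 k / rhoC r (γ q.1) q.2) := by
  have hρ := measurable_rhoC_orbit hγ r
  have hm := measurable_momC_orbit hγ r
  refine (hgc.measurable.comp (hρ.const_mul _)).mul (Finset.measurable_sum _ fun j _ => Finset.measurable_sum _ fun k _ => ?_)
  have ha : Measurable fun q : ℝ × T3 => a j k (q.1, q.2) := by
    have e : (fun q : ℝ × T3 => a j k (q.1, q.2)) = a j k := funext fun q => by rw [Prod.mk.eta]
    rw [e]; exact (hac j k).measurable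
  have hmj : ∀ i : Fin 3, Measurable fun q : ℝ × T3 => momC r (γ q.1) q.2 i := fun i =>
    (EuclideanSpace.proj i : V3 →L[ℝ] ℝ).continuous.measurable.comp hm
  exact ha.mul ((measurable_MpsiC_orbit hγ r (by fun_prop)).sub (((hmj j).mul (hmj k)).div hρ))

/-- **The time profile is bounded by the energy**: `|∫ₓ g(σ³ρ_r) Σ aⱼₖ Pⱼₖ| ≤ 30 Gb A ke` at every instant of `[0, τ]`
(`|a| ≤ A` on `[0, τ]`, `|g| ≤ Gb` on `[0, ∞)`, `0 ≤ σ`, `0 < r < 1/2`). [folklore] -/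
theorem abs_profile_le {r : ℝ} (hr : 0 < r) (hr2 : r < 1 / 2) {σ : ℝ} (hσ : 0 ≤ σ) (w : Phase N) {τ s : ℝ} (hs : s ∈ Icc 0 τ)
    (a : Fin 3 → Fin 3 → ℝ × T3 → ℝ) {A : ℝ} (hA : ∀ j k, ∀ s ∈ Icc 0 τ, ∀ x : T3, |a j k (s, x)| ≤ A)
    (g : ℝ → ℝ) {Gb : ℝ} (hGb : ∀ b, 0 ≤ b → |g b| ≤ Gb) :
    |∫ x : T3, g (σ ^ 3 * rhoC r w x) * ∑ j, ∑ k, a j k (s, x) *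
        (MpsiC r w x (fun v => v j * v k) - momC r w x j * momC r w x k / rhoC r w x)| ≤ 30 * Gb * A * ke w := by
  have hGb0 : 0 ≤ Gb := (abs_nonneg _).trans (hGb 0 le_rfl)
  have hA0 : 0 ≤ A := (abs_nonneg _).trans (hA 0 0 s hs 0)
  have hpt : ∀ x : T3, ‖g (σ ^ 3 * rhoC r w x) * ∑ j, ∑ k, a j k (s, x) *
      (MpsiC r w x (fun v => v j * v k) - momC r w x j * momC r w x k / rhoC r w x)‖ ≤ 30 * Gb * A * kinC r w x := by
    intro x
    rw [Real.norm_eq_abs, abs_mul]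
    have h1 : |∑ j, ∑ k, a j k (s, x) * (MpsiC r w x (fun v => v j * v k) - momC r w x j * momC r w x k / rhoC r w x)| ≤
        A * (30 * kinC r w x) := by
      calc _ ≤ ∑ j, ∑ k, A * |MpsiC r w x (fun v => v j * v k) - momC r w x j * momC r w x k / rhoC r w x| := by
            refine (Finset.abs_sum_le_sum_abs _ _).trans (Finset.sum_le_sum fun j _ => ?_)
            refine (Finset.abs_sum_le_sum_abs _ _).trans (Finset.sum_le_sum fun k _ => ?_)
            rw [abs_mul]; exact mul_le_mul_of_nonneg_right (hA j k s hs x) (abs_nonneg _)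
        _ = A * ∑ j, ∑ k, |MpsiC r w x (fun v => v j * v k) - momC r w x j * momC r w x k / rhoC r w x| := by
            rw [Finset.mul_sum]; exact Finset.sum_congr rfl fun j _ => by rw [Finset.mul_sum]
        _ ≤ A * (30 * kinC r w x) := mul_le_mul_of_nonneg_left (sum_abs_P_le hr w x) hA0
    calc |g (σ ^ 3 * rhoC r w x)| * |∑ j, ∑ k, a j k (s, x) *
          (MpsiC r w x (fun v => v j * v k) - momC r w x j * momC r w x k / rhoC r w x)|
        ≤ Gb * (A * (30 * kinC r w x)) :=
          mul_le_mul (hGb _ (mul_nonneg (pow_nonneg hσ 3) (rhoC_nonneg hr _ _))) h1 (abs_nonneg _) hGb0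
      _ = 30 * Gb * A * kinC r w x := by ring
  have hint : Integrable (fun x : T3 => 30 * Gb * A * kinC r w x) volume :=
    (integrable_of_continuous_T3 (continuous_kinC r w)).const_mul _
  rw [← Real.norm_eq_abs]
  refine (norm_integral_le_of_norm_le hint (ae_of_all _ hpt)).trans (le_of_eq ?_)
  rw [integral_const_mul, integral_kinC_eq_ke hr hr2]

/-! ## §4 The pathwise bound along one good orbit -/

set_option maxHeartbeats 1600000 in -- one declaration: the huge window-covariance literals of the six majorants
/-- **THE PATHWISE BOUND ALONG ONE GOOD ORBIT** (see the module docstring). [folklore] -/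
theorem pathwise_bound {σ : ℝ} (hσ : 0 < σ) (hσ2 : σ < 1 / 2)
    (Φ : HardSphereFlow (Torus.geometry (Fin 3)) (hsDiameter σ N) (N + 1)) {z : Phase N} (hz : z ∈ Φ.good)
    {r : ℝ} (hr : 0 < r) (hr2 : r < 1 / 2) {τ t : ℝ} (ht : 0 ≤ t) (htτ : t ≤ τ) {V : ℝ} (hV : 0 < V)
    (a : Fin 3 → Fin 3 → ℝ × T3 → ℝ) (hac : ∀ j k, Continuous (a j k)) (htr : ∀ p, ∑ j, a j j p = 0)
    {A : ℝ} (hA : ∀ j k, ∀ s ∈ Icc 0 τ, ∀ x : T3, |a j k (s, x)| ≤ A)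
    {κa : ℝ} (hκa0 : 0 ≤ κa)
    (hκa : ∀ j k, ∀ s ∈ Icc 0 τ, ∀ t₀ ∈ Icc 0 τ, ∀ x : T3, |s - t₀| ≤ r ^ 2 → |a j k (s, x) - a j k (t₀, x)| ≤ κa)
    (g : ℝ → ℝ) (hgc : Continuous g) {Gb : ℝ} (hGb : ∀ b, 0 ≤ b → |g b| ≤ Gb)
    {κg lam : ℝ} (hlam : 0 < lam) (hκg0 : 0 ≤ κg) (hκg : ∀ b b', 0 ≤ b → 0 ≤ b' → |b - b'| < lam → |g b - g b'| ≤ κg)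
    {Rcap : ℝ} (hcap : ∀ s ∈ Icc 0 τ, ∀ x : T3, rhoC r (Φ.flow s z) x ≤ Rcap)
    {KE : ℝ} (hKE : ke z ≤ KE)
    {κT : ℝ} (hκT : ∫ s in Icc 0 τ, ((N + 1 : ℕ) : ℝ)⁻¹ * ∑ i, sqTail V (Φ.flow s z i).2 ≤ κT)
    {Kb : ℝ} (hKb : hsDiameter σ N / (N + 1 : ℝ) * ∫ m, (1 + ‖m.2.2.2.1‖ ^ 4 + ‖m.2.2.2.2‖ ^ 4) * (1 + 1 / (Real.pi * ‖m.2.2.2.1 - m.2.2.2.2‖)) ∂(Φ.empiricalCollisionMeasure (Set.Icc 0 τ) z) ≤ Kb)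
    {ηW : ℝ} (hWp : ∫ t₀ in Icc 0 τ, ∫ x, max (g (σ ^ 3 * ∫ s in Icc 0 τ, (r ^ 2)⁻¹ * max (1 - |s - t₀| / r ^ 2) 0 * rhoC r (Φ.flow s z) x)) 0 * ∑ j : Fin 3, ∑ k : Fin 3, |((∫ s in Icc 0 τ, (r ^ 2)⁻¹ * max (1 - |s - t₀| / r ^ 2) 0 * MpsiC r (Φ.flow s z) x (fun v => v j * v k)) - (∫ s in Icc 0 τ, (r ^ 2)⁻¹ * max (1 - |s - t₀| / r ^ 2) 0 * MpsiC r (Φ.flow s z) x (fun v => v j)) * (∫ s in Icc 0 τ, (r ^ 2)⁻¹ * max (1 - |s - t₀| / r ^ 2) 0 * MpsiC r (Φ.flow s z) x (fun v => v k)) / (∫ s in Icc 0 τ, (r ^ 2)⁻¹ * max (1 - |s - t₀| / r ^ 2) 0 * rhoC r (Φ.flow s z) x)) - if j = k then (∑ l, ((∫ s in Icc 0 τ, (r ^ 2)⁻¹ * max (1 - |s - t₀| / r ^ 2) 0 * MpsiC r (Φ.flow s z) x (fun v => v l * v l)) - (∫ s in Icc 0 τ, (r ^ 2)⁻¹ *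 max (1 - |s - t₀| / r ^ 2) 0 * MpsiC r (Φ.flow s z) x (fun v => v l)) * (∫ s in Icc 0 τ, (r ^ 2)⁻¹ * max (1 - |s - t₀| / r ^ 2) 0 * MpsiC r (Φ.flow s z) x (fun v => v l)) / (∫ s in Icc 0 τ, (r ^ 2)⁻¹ * max (1 - |s - t₀| / r ^ 2) 0 * rhoC r (Φ.flow s z) x))) / 3 else 0| ≤ ηW) (hWm : ∫ t₀ in Icc 0 τ, ∫ x, max (-g (σ ^ 3 * ∫ s in Icc 0 τ, (r ^ 2)⁻¹ * max (1 - |s - t₀| / r ^ 2) 0 * rhoC r (Φ.flow s z) x)) 0 * ∑ j : Fin 3, ∑ k : Fin 3, |((∫ s in Icc 0 τ, (r ^ 2)⁻¹ * max (1 - |s - t₀| / r ^ 2) 0 * MpsiC r (Φ.flow s z) x (fun v => v j * v k)) - (∫ s in Icc 0 τ, (r ^ 2)⁻¹ * max (1 - |s - t₀| / r ^ 2) 0 * MpsiC r (Φ.flow s z) x (fun v => v j)) * (∫ s in Icc 0 τ, (r ^ 2)⁻¹ * max (1 - |s - t₀| / r ^ 2) 0 * MpsiC r (Φ.flow s z)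 x (fun v => v k)) / (∫ s in Icc 0 τ, (r ^ 2)⁻¹ * max (1 - |s - t₀| / r ^ 2) 0 * rhoC r (Φ.flow s z) x)) - if j = k then (∑ l, ((∫ s in Icc 0 τ, (r ^ 2)⁻¹ * max (1 - |s - t₀| / r ^ 2) 0 * MpsiC r (Φ.flow s z) x (fun v => v l * v l)) - (∫ s in Icc 0 τ, (r ^ 2)⁻¹ * max (1 - |s - t₀| / r ^ 2) 0 * MpsiC r (Φ.flow s z) x (fun v => v l)) * (∫ s in Icc 0 τ, (r ^ 2)⁻¹ * max (1 - |s - t₀| / r ^ 2) 0 * MpsiC r (Φ.flow s z) x (fun v => v l)) / (∫ s in Icc 0 τ, (r ^ 2)⁻¹ * max (1 - |s - t₀| / r ^ 2) 0 * rhoC r (Φ.flow s z) x))) / 3 else 0| ≤ ηW) :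
    |∫ s in Icc 0 t, ∫ x : T3, g (σ ^ 3 * rhoC r (Φ.flow s z) x) * ∑ j, ∑ k, a j k (s, x) * (MpsiC r (Φ.flow s z) x (fun v => v j * v k) - momC r (Φ.flow s z) x j * momC r (Φ.flow s z) x k / rhoC r (Φ.flow s z) x)| ≤
      4 * r ^ 2 * (30 * Gb * A * KE) + (A * (ηW + ηW) + Gb * (3 * A * (4 * V * (16 * KE * r * τ + 16 * r * Kb) + 4 * V ^ 2 * (8 * r * (1 / 2 + KE) * τ) + 6 * κT + 4 * κT)) + 30 * (Gb * κa + A * κg) * (KE * τ) + Gb * A * σ ^ 3 * Rcap / lam * (60 * V ^ 2 * (8 * r * (1 / 2 + KE) * τ) + 30 * κT)) := by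
  have hh : 0 < r ^ 2 := by positivity
  have htraj := Φ.isTrajectory z hz
  have hγ : Measurable fun s => Φ.flow s z := htraj.measurable_torus
  have hε0 : 0 ≤ hsDiameter σ N := (hsDiameter_pos hσ N).le
  have hτ0 : 0 ≤ τ := ht.trans htτ
  have h0mem : (0 : ℝ) ∈ Icc 0 τ := ⟨le_rfl, hτ0⟩
  have hGb0 : 0 ≤ Gb := (abs_nonneg _).trans (hGb 0 le_rfl)
  have hA0 : 0 ≤ A := (abs_nonneg _).trans (hA 0 0 0 h0mem 0)
  have hke : ∀ s, ke (Φ.flow s z) = ke z := fun s => by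
    rw [ke_traj_eq htraj s 0]; exact congrArg ke (Φ.flow_zero z hz)
  have hke0 : 0 ≤ ke z := ke_nonneg _
  have hC : 0 ≤ 3 / (Real.pi * r ^ 3) := by positivity
  set f : ℝ × T3 → ℝ := fun q => g (σ ^ 3 * rhoC r (Φ.flow q.1 z) q.2) * ∑ j, ∑ k, a j k (q.1, q.2) * (MpsiC r (Φ.flow q.1 z) q.2 (fun v => v j * v k) - momC r (Φ.flow q.1 z) q.2 j * momC r (Φ.flow q.1 z) q.2 k / rhoC r (Φ.flow q.1 z) q.2) with hfdef
  have hfm : Measurable f := measurable_wsiIntegrand hγ r σ a hac g hgc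
  set φ : ℝ → ℝ := fun s => ∫ x : T3, f (s, x) with hφdef
  have hφm : Measurable φ := (hfm.stronglyMeasurable.integral_prod_right' (ν := (volume : Measure T3))).measurable
  have hφb : ∀ s ∈ Icc 0 τ, |φ s| ≤ 30 * Gb * A * ke z := fun s hs => by
    have h1 := abs_profile_le hr hr2 hσ.le (Φ.flow s z) hs a hA g hGb
    rw [hke s] at h1; exact h1
  have hφi : IntegrableOn φ (Icc 0 τ) volume :=
    Measure.integrableOn_of_bounded (M := 30 * Gb * A * ke z) (by rw [Real.volume_Icc]; exact ENNReal.ofReal_ne_top)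
      hφm.aestronglyMeasurable ((ae_restrict_iff' measurableSet_Icc).2 (ae_of_all _ fun s hs => by
        rw [Real.norm_eq_abs]; exact hφb s hs))
  have hE := abs_integral_sub_windowed_le hh ht htτ hφi (C := 30 * Gb * A * ke z)
    (fun s hs => hφb s ⟨hs.1, hs.2.trans htτ⟩)
  -- ### Fubini per window centre: `∫_s w φ = ∫ₓ ∫_s w f`
  have hfb : ∀ q : ℝ × T3, q.1 ∈ Icc 0 τ → |f q| ≤ Gb * (A * (30 * (3 / (Real.pi * r ^ 3) * ke z))) := by
    intro q hq
    simp only [hfdef]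
    rw [abs_mul]
    refine mul_le_mul (hGb _ (mul_nonneg (pow_nonneg hσ.le 3) (rhoC_nonneg hr _ _))) ?_ (abs_nonneg _) hGb0
    calc _ ≤ ∑ j, ∑ k, A * |MpsiC r (Φ.flow q.1 z) q.2 (fun v => v j * v k) -
          momC r (Φ.flow q.1 z) q.2 j * momC r (Φ.flow q.1 z) q.2 k / rhoC r (Φ.flow q.1 z) q.2| := by
          refine (Finset.abs_sum_le_sum_abs _ _).trans (Finset.sum_le_sum fun j _ => ?_)
          refine (Finset.abs_sum_le_sum_abs _ _).trans (Finset.sum_le_sum fun k _ => ?_)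
          rw [abs_mul]; exact mul_le_mul_of_nonneg_right (hA j k q.1 hq q.2) (abs_nonneg _)
      _ = A * ∑ j, ∑ k, |MpsiC r (Φ.flow q.1 z) q.2 (fun v => v j * v k) -
          momC r (Φ.flow q.1 z) q.2 j * momC r (Φ.flow q.1 z) q.2 k / rhoC r (Φ.flow q.1 z) q.2| := by
          rw [Finset.mul_sum]; exact Finset.sum_congr rfl fun j _ => by rw [Finset.mul_sum]
      _ ≤ A * (30 * kinC r (Φ.flow q.1 z) q.2) := mul_le_mul_of_nonneg_left (sum_abs_P_le hr _ _) hA0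
      _ ≤ A * (30 * (3 / (Real.pi * r ^ 3) * ke z)) := by
          refine mul_le_mul_of_nonneg_left (mul_le_mul_of_nonneg_left ?_ (by norm_num)) hA0
          rw [← hke q.1]; exact (kinC_le_sup hr _ _).2
  have hw0 : ∀ a' : ℝ, 0 ≤ (r ^ 2)⁻¹ * max (1 - |a'| / r ^ 2) 0 := fun a' => (tent_nonneg_le hh a').1
  have hwle : ∀ a' : ℝ, (r ^ 2)⁻¹ * max (1 - |a'| / r ^ 2) 0 ≤ (r ^ 2)⁻¹ := fun a' => (tent_nonneg_le hh a').2
  have hFub : ∀ t₀, ∫ s in Icc 0 τ, (r ^ 2)⁻¹ * max (1 - |s - t₀| / r ^ 2) 0 * φ s =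
      ∫ x : T3, ∫ s in Icc 0 τ, (r ^ 2)⁻¹ * max (1 - |s - t₀| / r ^ 2) 0 * f (s, x) := by
    intro t₀
    have e1 : ∀ s, (r ^ 2)⁻¹ * max (1 - |s - t₀| / r ^ 2) 0 * φ s =
        ∫ x : T3, (r ^ 2)⁻¹ * max (1 - |s - t₀| / r ^ 2) 0 * f (s, x) := fun s => (integral_const_mul _ _).symm
    simp_rw [e1]
    have hprod : Integrable (uncurry fun (s : ℝ) (x : T3) => (r ^ 2)⁻¹ * max (1 - |s - t₀| / r ^ 2) 0 * f (s, x))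
        ((volume.restrict (Icc 0 τ)).prod (volume : Measure T3)) := by
      have hmeas : Measurable (uncurry fun (s : ℝ) (x : T3) => (r ^ 2)⁻¹ * max (1 - |s - t₀| / r ^ 2) 0 * f (s, x)) := by
        have ha : Measurable fun q : ℝ × T3 => (r ^ 2)⁻¹ * max (1 - |q.1 - t₀| / r ^ 2) 0 :=
          measurable_const.mul ((measurable_const.sub (((measurable_fst.sub measurable_const).abs).div_const _)).max
            measurable_const)
        have hb : Measurable fun q : ℝ × T3 => f (q.1, q.2) := by
          have e : (fun q : ℝ × T3 => f (q.1, q.2)) = f := funext fun q => by rw [Prod.mk.eta]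
          rw [e]; exact hfm
        exact ha.mul hb
      have hμ : (volume.restrict (Icc 0 τ)).prod (volume : Measure T3) =
          ((volume : Measure ℝ).prod (volume : Measure T3)).restrict (Icc 0 τ ×ˢ univ) := by
        rw [← Measure.prod_restrict, Measure.restrict_univ]
      rw [hμ]
      refine Measure.integrableOn_of_bounded (M := (r ^ 2)⁻¹ * (Gb * (A * (30 * (3 / (Real.pi * r ^ 3) * ke z)))))
        ?_ hmeas.aestronglyMeasurable ?_
      · rw [Measure.prod_prod, Real.volume_Icc]
        exact ENNReal.mul_ne_top ENNReal.ofReal_ne_top (measure_ne_top _ _)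
      · refine (ae_restrict_iff' (measurableSet_Icc.prod MeasurableSet.univ)).2 (ae_of_all _ fun q hq => ?_)
        simp only [uncurry, Real.norm_eq_abs]
        rw [abs_mul, abs_of_nonneg (hw0 _)]
        exact mul_le_mul (hwle _) (hfb q hq.1) (abs_nonneg _) (by positivity)
    exact integral_integral_swap hprod
  have hcore := windows_integral_le hε0 htraj hr hr2 ht htτ hV hσ.le a hac htr hA hκa0 hκa g hgc hGb hlam hκg0 hκg hcap
  beta_reduce at hcore
  rw [Φ.flow_zero z hz] at hcore
  have hmain_eq : ∫ t₀ in Icc (r ^ 2) (t - r ^ 2), ∫ s in Icc 0 τ, (r ^ 2)⁻¹ * max (1 - |s - t₀| / r ^ 2) 0 * φ s =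
      ∫ t₀ in Icc (r ^ 2) (t - r ^ 2), ∫ x : T3, ∫ s in Icc 0 τ, (r ^ 2)⁻¹ * max (1 - |s - t₀| / r ^ 2) 0 * f (s, x) :=
    integral_congr_ae (ae_of_all _ fun t₀ => hFub t₀)
  have hS := speedJump_le_two_mul_integral hσ hσ2 Φ hz τ
  have hcast : ((N + 1 : ℕ) : ℝ) = (N : ℝ) + 1 := by push_cast; ring
  have hquart0 : 0 ≤ ∫ m, (1 + ‖m.2.2.2.1‖ ^ 4 + ‖m.2.2.2.2‖ ^ 4) * (1 + 1 / (Real.pi * ‖m.2.2.2.1 - m.2.2.2.2‖)) ∂(Φ.empiricalCollisionMeasure (Set.Icc 0 τ) z) := by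
    have h0 := ctf_nonneg (fun (i _ : Fin (N + 1)) (pre post : Phase N) => norm_nonneg ((post i).2 - (pre i).2))
      (γ := fun s => Φ.flow s z) (G := Torus.geometry (Fin 3)) (ε := hsDiameter σ N) 0 τ
    linarith
  have hSterm : ((N + 1 : ℕ) : ℝ)⁻¹ * (8 * hsDiameter σ N * r) * collisionalTransferFunctional (Torus.geometry (Fin 3)) (hsDiameter σ N) (fun i _ pre post => ‖(post i).2 - (pre i).2‖) (fun s => Φ.flow s z) 0 τ ≤ 16 * r * Kb := by
    have h1 : ((N + 1 : ℕ) : ℝ)⁻¹ * (8 * hsDiameter σ N * r) * collisionalTransferFunctional (Torus.geometry (Fin 3)) (hsDiameter σ N) (fun i _ pre post => ‖(post i).2 - (pre i).2‖) (fun s => Φ.flow s z) 0 τ ≤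
        ((N + 1 : ℕ) : ℝ)⁻¹ * (8 * hsDiameter σ N * r) * (2 * ∫ m, (1 + ‖m.2.2.2.1‖ ^ 4 + ‖m.2.2.2.2‖ ^ 4) * (1 + 1 / (Real.pi * ‖m.2.2.2.1 - m.2.2.2.2‖)) ∂(Φ.empiricalCollisionMeasure (Set.Icc 0 τ) z)) :=
      mul_le_mul_of_nonneg_left hS (by positivity)
    have h2 : ((N + 1 : ℕ) : ℝ)⁻¹ * (8 * hsDiameter σ N * r) * (2 * ∫ m, (1 + ‖m.2.2.2.1‖ ^ 4 + ‖m.2.2.2.2‖ ^ 4) * (1 + 1 / (Real.pi * ‖m.2.2.2.1 - m.2.2.2.2‖)) ∂(Φ.empiricalCollisionMeasure (Set.Icc 0 τ) z)) =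
        16 * r * (hsDiameter σ N / (N + 1 : ℝ) * ∫ m, (1 + ‖m.2.2.2.1‖ ^ 4 + ‖m.2.2.2.2‖ ^ 4) * (1 + 1 / (Real.pi * ‖m.2.2.2.1 - m.2.2.2.2‖)) ∂(Φ.empiricalCollisionMeasure (Set.Icc 0 τ) z)) := by
      rw [hcast]; ring
    rw [h2] at h1
    exact h1.trans (mul_le_mul_of_nonneg_left hKb (by positivity))
  have hDsum : (∫ t₀ in Icc 0 τ, ∫ x, max (g (σ ^ 3 * ∫ s in Icc 0 τ, (r ^ 2)⁻¹ * max (1 - |s - t₀| / r ^ 2) 0 * rhoC r (Φ.flow s z) x)) 0 * ∑ j : Fin 3, ∑ k : Fin 3, |((∫ s in Icc 0 τ, (r ^ 2)⁻¹ * max (1 - |s - t₀| / r ^ 2) 0 * MpsiC r (Φ.flow s z) x (fun v => v j * v k)) - (∫ s in Icc 0 τ, (r ^ 2)⁻¹ * max (1 - |s - t₀| / r ^ 2) 0 * MpsiC r (Φ.flow s z) x (fun v => v j)) * (∫ s in Icc 0 τ, (r ^ 2)⁻¹ * max (1 - |s - t₀| / r ^ 2) 0 * MpsiC r (Φ.flow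 s z) x (fun v => v k)) / (∫ s in Icc 0 τ, (r ^ 2)⁻¹ * max (1 - |s - t₀| / r ^ 2) 0 * rhoC r (Φ.flow s z) x)) - if j = k then (∑ l, ((∫ s in Icc 0 τ, (r ^ 2)⁻¹ * max (1 - |s - t₀| / r ^ 2) 0 * MpsiC r (Φ.flow s z) x (fun v => v l * v l)) - (∫ s in Icc 0 τ, (r ^ 2)⁻¹ * max (1 - |s - t₀| / r ^ 2) 0 * MpsiC r (Φ.flow s z) x (fun v => v l)) * (∫ s in Icc 0 τ, (r ^ 2)⁻¹ * max (1 - |s - t₀| / r ^ 2) 0 * MpsiC r (Φ.flow s z) x (fun v => v l)) / (∫ s in Icc 0 τ, (r ^ 2)⁻¹ * max (1 - |s - t₀| / r ^ 2) 0 * rhoC r (Φ.flow s z) x))) / 3 else 0|) + (∫ t₀ in Icc 0 τ, ∫ x, max (-g (σ ^ 3 * ∫ s in Icc 0 τ, (r ^ 2)⁻¹ * max (1 - |s - t₀| / r ^ 2) 0 * rhoC r (Φ.flow s z) x)) 0 * ∑ j : Fin 3, ∑ k : Fin 3, |((∫ s in Icc 0 τ, (r ^ 2)⁻¹ * max (1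 - |s - t₀| / r ^ 2) 0 * MpsiC r (Φ.flow s z) x (fun v => v j * v k)) - (∫ s in Icc 0 τ, (r ^ 2)⁻¹ * max (1 - |s - t₀| / r ^ 2) 0 * MpsiC r (Φ.flow s z) x (fun v => v j)) * (∫ s in Icc 0 τ, (r ^ 2)⁻¹ * max (1 - |s - t₀| / r ^ 2) 0 * MpsiC r (Φ.flow s z) x (fun v => v k)) / (∫ s in Icc 0 τ, (r ^ 2)⁻¹ * max (1 - |s - t₀| / r ^ 2) 0 * rhoC r (Φ.flow s z) x)) - if j = k then (∑ l, ((∫ s in Icc 0 τ, (r ^ 2)⁻¹ * max (1 - |s - t₀| / r ^ 2) 0 * MpsiC r (Φ.flow s z) x (fun v => v l * v l)) - (∫ s in Icc 0 τ, (r ^ 2)⁻¹ * max (1 - |s - t₀| / r ^ 2) 0 * MpsiC r (Φ.flow s z) x (fun v => v l)) * (∫ s in Icc 0 τ, (r ^ 2)⁻¹ * max (1 - |s - t₀| / r ^ 2) 0 * MpsiC r (Φ.flow s z) x (fun v => v l)) / (∫ s in Icc 0 τ, (r ^ 2)⁻¹ * max (1 - |s - t₀| / r ^ 2) 0 * rhoC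 r (Φ.flow s z) x))) / 3 else 0|) ≤ ηW + ηW := add_le_add hWp hWm
  have hRcap0 : 0 ≤ Rcap := (rhoC_nonneg hr _ _).trans (hcap 0 h0mem 0)
  have hKE0 : 0 ≤ KE := hke0.trans hKE
  have hTail0 : 0 ≤ ∫ s in Icc 0 τ, ((N + 1 : ℕ) : ℝ)⁻¹ * ∑ i, sqTail V (Φ.flow s z i).2 :=
    integral_nonneg fun s => mul_nonneg (by positivity) (Finset.sum_nonneg fun i _ => sqTail_nonneg V _)
  have hmono : A * ((∫ t₀ in Icc 0 τ, ∫ x, max (g (σ ^ 3 * ∫ s in Icc 0 τ, (r ^ 2)⁻¹ * max (1 - |s - t₀| / r ^ 2) 0 * rhoC r (Φ.flow s z) x)) 0 * ∑ j : Fin 3, ∑ k : Fin 3, |((∫ s in Icc 0 τ, (r ^ 2)⁻¹ * max (1 - |s - t₀| / r ^ 2) 0 * MpsiC r (Φ.flow s z) x (fun v => v j * v k)) - (∫ s in Icc 0 τ, (r ^ 2)⁻¹ * max (1 - |s - t₀| / r ^ 2) 0 * MpsiC r (Φ.flow s z) x (fun v => v j)) * (∫ s in Icc 0 τ, (r ^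 2)⁻¹ * max (1 - |s - t₀| / r ^ 2) 0 * MpsiC r (Φ.flow s z) x (fun v => v k)) / (∫ s in Icc 0 τ, (r ^ 2)⁻¹ * max (1 - |s - t₀| / r ^ 2) 0 * rhoC r (Φ.flow s z) x)) - if j = k then (∑ l, ((∫ s in Icc 0 τ, (r ^ 2)⁻¹ * max (1 - |s - t₀| / r ^ 2) 0 * MpsiC r (Φ.flow s z) x (fun v => v l * v l)) - (∫ s in Icc 0 τ, (r ^ 2)⁻¹ * max (1 - |s - t₀| / r ^ 2) 0 * MpsiC r (Φ.flow s z) x (fun v => v l)) * (∫ s in Icc 0 τ, (r ^ 2)⁻¹ * max (1 - |s - t₀| / r ^ 2) 0 * MpsiC r (Φ.flow s z) x (fun v => v l)) / (∫ s in Icc 0 τ, (r ^ 2)⁻¹ * max (1 - |s - t₀| / r ^ 2) 0 * rhoC r (Φ.flow s z) x))) / 3 else 0|) + (∫ t₀ in Icc 0 τ, ∫ x, max (-g (σ ^ 3 * ∫ s in Icc 0 τ, (r ^ 2)⁻¹ * max (1 - |s - t₀| / r ^ 2) 0 * rhoC r (Φ.flow s z) x)) 0 * ∑ j : Fin 3,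 ∑ k : Fin 3, |((∫ s in Icc 0 τ, (r ^ 2)⁻¹ * max (1 - |s - t₀| / r ^ 2) 0 * MpsiC r (Φ.flow s z) x (fun v => v j * v k)) - (∫ s in Icc 0 τ, (r ^ 2)⁻¹ * max (1 - |s - t₀| / r ^ 2) 0 * MpsiC r (Φ.flow s z) x (fun v => v j)) * (∫ s in Icc 0 τ, (r ^ 2)⁻¹ * max (1 - |s - t₀| / r ^ 2) 0 * MpsiC r (Φ.flow s z) x (fun v => v k)) / (∫ s in Icc 0 τ, (r ^ 2)⁻¹ * max (1 - |s - t₀| / r ^ 2) 0 * rhoC r (Φ.flow s z) x)) - if j = k then (∑ l, ((∫ s in Icc 0 τ, (r ^ 2)⁻¹ * max (1 - |s - t₀| / r ^ 2) 0 * MpsiC r (Φ.flow s z) x (fun v => v l * v l)) - (∫ s in Icc 0 τ, (r ^ 2)⁻¹ * max (1 - |s - t₀| / r ^ 2) 0 * MpsiC r (Φ.flow s z) x (fun v => v l)) * (∫ s in Icc 0 τ, (r ^ 2)⁻¹ * max (1 - |s - t₀| / r ^ 2) 0 * MpsiC r (Φ.flow s z) x (fun v => v l)) / (∫ s in Icc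 0 τ, (r ^ 2)⁻¹ * max (1 - |s - t₀| / r ^ 2) 0 * rhoC r (Φ.flow s z) x))) / 3 else 0|)) + Gb * (3 * A * (4 * V * (16 * ke z * r * τ + ((N + 1 : ℕ) : ℝ)⁻¹ * (8 * hsDiameter σ N * r) * collisionalTransferFunctional (Torus.geometry (Fin 3)) (hsDiameter σ N) (fun i _ pre post => ‖(post i).2 - (pre i).2‖) (fun s => Φ.flow s z) 0 τ) + 4 * V ^ 2 * (8 * r * (1 / 2 + ke z) * τ) + 6 * (∫ s in Icc 0 τ, ((N + 1 : ℕ) : ℝ)⁻¹ * ∑ i, sqTail V (Φ.flow s z i).2) + 4 * (∫ s in Icc 0 τ, ((N + 1 : ℕ) : ℝ)⁻¹ * ∑ i, sqTail V (Φ.flow s z i).2))) + 30 * (Gb * κa + A * κg) * (ke z * τ) + Gb * A * σ ^ 3 * Rcap / lam * (60 * V ^ 2 * (8 * r * (1 / 2 + ke z) * τ) + 30 * (∫ s in Icc 0 τ, ((N + 1 : ℕ) : ℝ)⁻¹ * ∑ i, sqTail V (Φ.flow s z i).2)) ≤ A * (ηW + ηW) + Gb * (3 * A * (4 * V * (16 *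 KE * r * τ + 16 * r * Kb) + 4 * V ^ 2 * (8 * r * (1 / 2 + KE) * τ) + 6 * κT + 4 * κT)) + 30 * (Gb * κa + A * κg) * (KE * τ) + Gb * A * σ ^ 3 * Rcap / lam * (60 * V ^ 2 * (8 * r * (1 / 2 + KE) * τ) + 30 * κT) := by
    have hBm : 16 * ke z * r * τ + ((N + 1 : ℕ) : ℝ)⁻¹ * (8 * hsDiameter σ N * r) * collisionalTransferFunctional (Torus.geometry (Fin 3)) (hsDiameter σ N) (fun i _ pre post => ‖(post i).2 - (pre i).2‖) (fun s => Φ.flow s z) 0 τ ≤ 16 * KE * r * τ + 16 * r * Kb :=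
      add_le_add (mul_le_mul_of_nonneg_right (mul_le_mul_of_nonneg_right (mul_le_mul_of_nonneg_left hKE (by norm_num))
        hr.le) hτ0) hSterm
    have hBr : 8 * r * (1 / 2 + ke z) * τ ≤ 8 * r * (1 / 2 + KE) * τ :=
      mul_le_mul_of_nonneg_right (mul_le_mul_of_nonneg_left (by linarith) (by positivity)) hτ0
    have h3A : 0 ≤ 3 * A := by positivity
    have h4V : 0 ≤ 4 * V := by positivity
    have h4V2 : 0 ≤ 4 * V ^ 2 := by positivity
    have hlast : 0 ≤ Gb * A * σ ^ 3 * Rcap / lam := by positivity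
    exact add_le_add (add_le_add (add_le_add (mul_le_mul_of_nonneg_left hDsum hA0)
      (mul_le_mul_of_nonneg_left (mul_le_mul_of_nonneg_left (add_le_add (add_le_add (add_le_add
        (mul_le_mul_of_nonneg_left hBm h4V) (mul_le_mul_of_nonneg_left hBr h4V2)) (mul_le_mul_of_nonneg_left hκT (by norm_num)))
        (mul_le_mul_of_nonneg_left hκT (by norm_num))) h3A) hGb0))
      (mul_le_mul_of_nonneg_left (mul_le_mul_of_nonneg_right hKE hτ0) (by positivity)))
      (mul_le_mul_of_nonneg_left (add_le_add (mul_le_mul_of_nonneg_left hBr (by positivity))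
        (mul_le_mul_of_nonneg_left hκT (by norm_num))) hlast)
  have hdiff : |(∫ s in Icc 0 t, ∫ x : T3, f (s, x)) -
      ∫ t₀ in Icc (r ^ 2) (t - r ^ 2), ∫ x : T3, ∫ s in Icc 0 τ, (r ^ 2)⁻¹ * max (1 - |s - t₀| / r ^ 2) 0 * f (s, x)| ≤
      4 * r ^ 2 * (30 * Gb * A * ke z) := by
    rw [← hmain_eq]; exact hE
  have h4 : 4 * r ^ 2 * (30 * Gb * A * ke z) ≤ 4 * r ^ 2 * (30 * Gb * A * KE) := by gcongr
  calc |∫ s in Icc 0 t, ∫ x : T3, f (s, x)|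
      ≤ |(∫ s in Icc 0 t, ∫ x : T3, f (s, x)) -
          ∫ t₀ in Icc (r ^ 2) (t - r ^ 2), ∫ x : T3, ∫ s in Icc 0 τ, (r ^ 2)⁻¹ * max (1 - |s - t₀| / r ^ 2) 0 * f (s, x)| +
        |∫ t₀ in Icc (r ^ 2) (t - r ^ 2), ∫ x : T3, ∫ s in Icc 0 τ, (r ^ 2)⁻¹ * max (1 - |s - t₀| / r ^ 2) 0 * f (s, x)| := by
          have := abs_add_le ((∫ s in Icc 0 t, ∫ x : T3, f (s, x)) -
            ∫ t₀ in Icc (r ^ 2) (t - r ^ 2), ∫ x : T3, ∫ s in Icc 0 τ, (r ^ 2)⁻¹ * max (1 - |s - t₀| / r ^ 2) 0 * f (s, x))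
            (∫ t₀ in Icc (r ^ 2) (t - r ^ 2), ∫ x : T3, ∫ s in Icc 0 τ, (r ^ 2)⁻¹ * max (1 - |s - t₀| / r ^ 2) 0 * f (s, x))
          rwa [sub_add_cancel] at this
    _ ≤ 4 * r ^ 2 * (30 * Gb * A * KE) + (A * (ηW + ηW) + Gb * (3 * A * (4 * V * (16 * KE * r * τ + 16 * r * Kb) + 4 * V ^ 2 * (8 * r * (1 / 2 + KE) * τ) + 6 * κT + 4 * κT)) + 30 * (Gb * κa + A * κg) * (KE * τ) + Gb * A * σ ^ 3 * Rcap / lam * (60 * V ^ 2 * (8 * r * (1 / 2 + KE) * τ) + 30 * κT)) := add_le_add (hdiff.trans h4) (hcore.trans hmono)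

/-- **Registered sub-goal `stub_stressIsotropyOfWindowCovarianceK` (helper K of
`stub_stressIsotropyOfWindowCovariance`)**: from an `ℝ≥0∞` bound on the extended norm to a real bound. [folklore] -/
theorem stub_stressIsotropyOfWindowCovarianceK : ∀ {x B : ℝ}, 0 ≤ B → ‖x‖ₑ ≤ ENNReal.ofReal B → |x| ≤ B := fun hB h => abs_le_of_enorm_le hB h

end Summit.AtomisticToContinuum.HydrodynamicLimit.Theorems.ParityBandClosureWindowToCone

end
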